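import Mathlib.RingTheory.PowerSeries.Substitution
import Mathlib.Topology.Algebra.InfiniteSum.Nonarchimedean
import Mathlib.Analysis.Normed.Group.Ultra
import Literature.NumberTheory.EllipticCurves.PAdicPowerSeriesZeros
import HarnessLib

/-!
# Evaluation on the open unit disc of `ℂ_p` commutes with substitution of an integral power
# series without constant term (cell `b2b-bsdres`, sub-cell additive-p2, gen 21)

HONEST FRAMING (cell `b2b-bsdres`, run/shared/lean/b2b/bsd-rank1-residual/, verbatim in every
file): the goal of the cell is to DELETE the COMBINATION-SHAPED residual classes of the
Birch–Swinnerton-Dyer formula for ALL analytic-rank `≤ 1` elliptic curves over `ℚ` — "full BSD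
formula for every rank `≤ 1` curve in class `C`" assembled STRICTLY from published theorems — so
that the rank-`≤ 1` remainder becomes exactly the CONSTRUCTION-SHAPED classes, which are TYPED
(missing-input `Prop`s), NOT attempted. This is not "finishing BSD". Research route on the
CONSTRUCTION-SHAPED classes X3♯(G-ord)/X4♯(G-ord) (sub-cell additive-p2, gen 21); THEOREMS ONLY —
no definition, no named fact, no conjecture node; labels / RESIDUAL-MAP marks UNCHANGED; nothing
booked.

For a power series `A` whose coefficients have bounded images under `ι : R → ℂ_p`, a power series
`Q` without constant term whose coefficients have images of norm `≤ 1`, and a point `z ∈ ℂ_p` with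
`|z| < 1` at which `Q` has the value `w` (so `|w| < 1`), the series defining the value of the
formal composite `A ∘ Q = A.subst Q` at `z` converges to the value of `A` at `w`:
`∑_n ι([T^n](A ∘ Q)) z^n = ∑_k ι([T^k]A) w^k` (`hasSum_map_coeff_subst_mul_pow`). The proof is
the Fubini rearrangement of the double family `ι(a_k) · ι([T^n]Q^k) · z^n`, which tends to `0`
along the cofinite filter (`[T^n]Q^k = 0` for `n < k`, and the terms are bounded by `C |z|^n`), hence
is summable in the complete nonarchimedean field `ℂ_p`
(`NonarchimedeanAddGroup.summable_of_tendsto_cofinite_zero`); summing over `n` first gives the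
values `w^k` of the powers `Q^k` (the evaluation is multiplicative, tree lemma
`tsum_map_coeff_mul_mul_pow`), summing over `k` first gives the coefficients of `A ∘ Q` (Mathlib
`PowerSeries.coeff_subst'`, a finite sum). Used to evaluate `B((1+T)^p - 1)` at the points
`κ(γ) - 1` of the cyclotomic characters (`TameBranchRigidity.lean`); the same rearrangement for the
two-variable formal group law is the tree's `hasSum_padicEval₂_powerSeries_subst`
(`FormalGroupPadicLogPointProofs.lean`, Silverman AEC IV.6.4).

## Main results (theorems only; no definitions)

* `norm_map_coeff_pow_le_one` — powers of an `ι`-integral series are `ι`-integral (ultrametric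
  inequality on the Cauchy product).
* `coeff_pow_eq_zero_of_lt` — `[T^n]Q^k = 0` for `n < k` when `Q(0) = 0`.
* `hasSum_map_coeff_pow_mul_pow` — the value of `Q^k` at `z` is `w^k`.
* `summable_map_coeff_mul_coeff_pow_mul_pow` — summability of the double family.
* `hasSum_map_coeff_subst_mul_pow` — **evaluation commutes with substitution**.

## References

* L. C. Washington, *Introduction to cyclotomic fields*, GTM 83, §7.1–7.2 (power series with
  bounded coefficients as functions on the open unit disc); J. H. Silverman, AEC IV.6.4 (the same
  rearrangement for formal groups). [folklore]
-/

noncomputable section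

open Filter

namespace Summit.BirchSwinnertonDyer.Rank1Residual.Additive

open Literature.NumberTheory.EllipticCurves

section SubstEval

open _root_.PowerSeries

variable {p : ℕ} [Fact p.Prime] {R : Type*} [CommRing R] (ι : R →+* ℂ_[p])

/-- Products of `ι`-integral power series are `ι`-integral (ultrametric inequality on the Cauchy
product `[T^n](Q Q') = ∑_{i+j=n} [T^i]Q [T^j]Q'`). [folklore] -/
theorem norm_map_coeff_mul_le_one {Q Q' : PowerSeries R} (hQ : ∀ k, ‖ι (coeff k Q)‖ ≤ 1)
    (hQ' : ∀ k, ‖ι (coeff k Q')‖ ≤ 1) (n : ℕ) : ‖ι (coeff n (Q * Q'))‖ ≤ 1 := by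
  rw [coeff_mul, map_sum]
  refine IsUltrametricDist.norm_sum_le_of_forall_le_of_nonneg zero_le_one fun ij _ ↦ ?_
  rw [map_mul, norm_mul]
  calc ‖ι (coeff ij.1 Q)‖ * ‖ι (coeff ij.2 Q')‖ ≤ 1 * 1 :=
        mul_le_mul (hQ _) (hQ' _) (norm_nonneg _) zero_le_one
    _ = 1 := one_mul 1

/-- Powers of an `ι`-integral power series are `ι`-integral. [folklore] -/
theorem norm_map_coeff_pow_le_one {Q : PowerSeries R} (hQ : ∀ k, ‖ι (coeff k Q)‖ ≤ 1) (d n : ℕ) :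
    ‖ι (coeff n (Q ^ d))‖ ≤ 1 := by
  induction d generalizing n with
  | zero =>
    rw [pow_zero, coeff_one]
    split_ifs
    · rw [map_one, norm_one]
    · rw [map_zero, norm_zero]; exact zero_le_one
  | succ d ih =>
    rw [pow_succ]
    exact norm_map_coeff_mul_le_one ι ih hQ n

omit [Fact p.Prime] in
/-- `[T^n]Q^d = 0` for `n < d` when `Q` has no constant term (`T^d ∣ Q^d`). [folklore] -/
theorem coeff_pow_eq_zero_of_lt {Q : PowerSeries R} (hQ0 : constantCoeff Q = 0) {d n : ℕ}
    (h : n < d) : coeff n (Q ^ d) = 0 := by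
  have hX : (X : PowerSeries R) ∣ Q := by rwa [X_dvd_iff]
  exact (X_pow_dvd_iff.mp (pow_dvd_pow_of_dvd hX d)) n h

/-- **The value of `Q^d` at `z` is `w^d`** if `Q` (with `ι`-integral coefficients) has the value
`w` at `|z| < 1` — the evaluation on the open unit disc is multiplicative
(`tsum_map_coeff_mul_mul_pow`). [folklore] -/
theorem hasSum_map_coeff_pow_mul_pow {Q : PowerSeries R} (hQ : ∀ k, ‖ι (coeff k Q)‖ ≤ 1)
    {z : ℂ_[p]} (hz : ‖z‖ < 1) {w : ℂ_[p]} (hw : HasSum (fun k ↦ ι (coeff k Q) * z ^ k) w)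
    (d : ℕ) : HasSum (fun k ↦ ι (coeff k (Q ^ d)) * z ^ k) (w ^ d) := by
  induction d with
  | zero =>
    rw [pow_zero, pow_zero]
    exact hasSum_map_coeff_one_mul_pow ι z
  | succ d ih =>
    have hs := summable_map_coeff_mul_pow ι (norm_map_coeff_pow_le_one ι hQ (d + 1)) hz
    have ht : ∑' k, ι (coeff k (Q ^ (d + 1))) * z ^ k = w ^ (d + 1) := by
      rw [pow_succ, tsum_map_coeff_mul_mul_pow ι (norm_map_coeff_pow_le_one ι hQ d) hQ hz,
        ih.tsum_eq, hw.tsum_eq, pow_succ]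
    rw [← ht]
    exact hs.hasSum

/-- **Summability of the double family** `(d, n) ↦ ι(a_d) · ι([T^n]Q^d) · z^n` for `A` with
`ι`-bounded coefficients, `Q` `ι`-integral without constant term and `|z| < 1`: the term vanishes
unless `d ≤ n` and is bounded by `C |z|^n`, which tends to `0`; a family tending to `0` along the
cofinite filter is summable in the complete nonarchimedean field `ℂ_p`. [folklore] -/
theorem summable_map_coeff_mul_coeff_pow_mul_pow {A Q : PowerSeries R} {C : ℝ}
    (hA : ∀ k, ‖ι (coeff k A)‖ ≤ C) (hQ : ∀ k, ‖ι (coeff k Q)‖ ≤ 1)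
    (hQ0 : constantCoeff Q = 0) {z : ℂ_[p]} (hz : ‖z‖ < 1) :
    Summable fun x : ℕ × ℕ ↦ ι (coeff x.1 A) * (ι (coeff x.2 (Q ^ x.1)) * z ^ x.2) := by
  refine NonarchimedeanAddGroup.summable_of_tendsto_cofinite_zero ?_
  have hC0 : 0 ≤ C := (norm_nonneg _).trans (hA 0)
  have hz0 : 0 ≤ ‖z‖ := norm_nonneg z
  -- the bound `‖term (d, n)‖ ≤ C ‖z‖^n`, and `= 0` if `n < d`
  have hbound : ∀ x : ℕ × ℕ,
      ‖ι (coeff x.1 A) * (ι (coeff x.2 (Q ^ x.1)) * z ^ x.2)‖ ≤ C * ‖z‖ ^ x.2 := by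
    rintro ⟨d, n⟩
    dsimp only
    rw [norm_mul, norm_mul, norm_pow]
    calc ‖ι (coeff d A)‖ * (‖ι (coeff n (Q ^ d))‖ * ‖z‖ ^ n) ≤ C * (1 * ‖z‖ ^ n) := by
          gcongr
          · exact hA d
          · exact norm_map_coeff_pow_le_one ι hQ d n
      _ = C * ‖z‖ ^ n := by rw [one_mul]
  have hzero : ∀ x : ℕ × ℕ, x.2 < x.1 →
      ι (coeff x.1 A) * (ι (coeff x.2 (Q ^ x.1)) * z ^ x.2) = 0 := by
    rintro ⟨d, n⟩ h
    dsimp only at h ⊢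
    rw [coeff_pow_eq_zero_of_lt hQ0 h, map_zero, zero_mul, mul_zero]
  -- `C ‖z‖^n → 0`
  rw [NormedAddGroup.tendsto_nhds_zero]
  intro ε hε
  obtain ⟨N, hN⟩ : ∃ N : ℕ, ∀ n, N ≤ n → C * ‖z‖ ^ n < ε := by
    have h := (tendsto_pow_atTop_nhds_zero_of_lt_one hz0 hz).const_mul C
    rw [mul_zero] at h
    rw [Metric.tendsto_atTop] at h
    obtain ⟨N, hN⟩ := h ε hε
    refine ⟨N, fun n hn ↦ ?_⟩
    have := hN n hn
    rwa [Real.dist_eq, sub_zero, abs_of_nonneg (mul_nonneg hC0 (pow_nonneg hz0 _))] at this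
  -- the exceptional set is finite
  have hfin : {x : ℕ × ℕ | x.1 ≤ x.2 ∧ x.2 < N}.Finite := by
    refine ((Set.finite_Iio N).prod (Set.finite_Iio N)).subset ?_
    rintro ⟨d, n⟩ ⟨h1, h2⟩
    simp only [Set.mem_prod, Set.mem_Iio]
    exact ⟨by omega, h2⟩
  rw [Filter.eventually_cofinite]
  refine hfin.subset fun x hx ↦ ?_
  simp only [Set.mem_setOf_eq] at hx ⊢
  have hx' := not_lt.mp hx
  by_contra hcon
  push Not at hcon
  rcases lt_or_ge x.2 x.1 with hlt | hle
  · rw [hzero x hlt, norm_zero] at hx'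
    exact absurd hε (not_lt.mpr hx')
  · exact absurd ((hbound x).trans_lt (hN _ (hcon hle))) (not_lt.mpr hx')

omit [Fact p.Prime] in
/-- The coefficient of the composite as a FINITE sum: `[T^n](A ∘ Q) = ∑_{d ≤ n} a_d [T^n]Q^d` for
`Q` without constant term (Mathlib `PowerSeries.coeff_subst'`). [folklore] -/
theorem coeff_subst_eq_sum_range {A Q : PowerSeries R} (hQ0 : constantCoeff Q = 0) (n : ℕ) :
    coeff n (A.subst Q) = ∑ d ∈ Finset.range (n + 1), coeff d A * coeff n (Q ^ d) := by
  rw [coeff_subst' (HasSubst.of_constantCoeff_zero' hQ0)]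
  have hsub : (Function.support fun d : ℕ ↦ coeff d A • coeff n (Q ^ d)) ⊆
      ↑(Finset.range (n + 1)) := by
    intro d hd
    rw [Function.mem_support] at hd
    simp only [Finset.coe_range, Set.mem_Iio]
    by_contra hnd
    exact hd (by rw [coeff_pow_eq_zero_of_lt hQ0 (by omega), smul_zero])
  rw [finsum_eq_sum_of_support_subset _ hsub]
  simp only [smul_eq_mul]

/-- **Evaluation on the open unit disc commutes with substitution.** Let `A ∈ R⟦T⟧` have
`ι`-bounded coefficients, `Q ∈ R⟦T⟧` be `ι`-integral without constant term, `|z| < 1` in `ℂ_p`,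
and let `w` be the value of `Q` at `z` (automatically `|w| < 1`). Then the value series of the formal
composite `A.subst Q` at `z` converges to the value of `A` at `w`:
`∑_n ι([T^n](A ∘ Q)) z^n = ∑_k ι(a_k) w^k` (Washington GTM 83 §7.1–7.2; the Fubini rearrangement
of `summable_map_coeff_mul_coeff_pow_mul_pow`). [folklore] -/
theorem hasSum_map_coeff_subst_mul_pow {A Q : PowerSeries R} {C : ℝ}
    (hA : ∀ k, ‖ι (coeff k A)‖ ≤ C) (hQ : ∀ k, ‖ι (coeff k Q)‖ ≤ 1)
    (hQ0 : constantCoeff Q = 0) {z : ℂ_[p]} (hz : ‖z‖ < 1) {w : ℂ_[p]}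
    (hw : HasSum (fun k ↦ ι (coeff k Q) * z ^ k) w) :
    HasSum (fun n ↦ ι (coeff n (A.subst Q)) * z ^ n) (∑' k, ι (coeff k A) * w ^ k) := by
  have hsum := summable_map_coeff_mul_coeff_pow_mul_pow ι hA hQ hQ0 hz
  -- summing over `n` first: the value of `A` at `w`
  have h1 : HasSum (fun d : ℕ ↦ ι (coeff d A) * w ^ d)
      (∑' x : ℕ × ℕ, ι (coeff x.1 A) * (ι (coeff x.2 (Q ^ x.1)) * z ^ x.2)) := by
    refine hsum.hasSum.prod_fiberwise fun d ↦ ?_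
    dsimp only
    exact (hasSum_map_coeff_pow_mul_pow ι hQ hz hw d).mul_left _
  have hval : ∑' k, ι (coeff k A) * w ^ k =
      ∑' x : ℕ × ℕ, ι (coeff x.1 A) * (ι (coeff x.2 (Q ^ x.1)) * z ^ x.2) := by
    rw [h1.tsum_eq]
  -- summing over `d` first: the coefficients of `A ∘ Q`
  have hsum' := (Equiv.prodComm ℕ ℕ).summable_iff.mpr hsum
  have h2 : HasSum (fun n : ℕ ↦ ι (coeff n (A.subst Q)) * z ^ n)
      (∑' y : ℕ × ℕ, ι (coeff y.2 A) * (ι (coeff y.1 (Q ^ y.2)) * z ^ y.1)) := by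
    refine hsum'.hasSum.prod_fiberwise fun n ↦ ?_
    have hfin : HasSum (fun d : ℕ ↦ ι (coeff d A) * (ι (coeff n (Q ^ d)) * z ^ n))
        (∑ d ∈ Finset.range (n + 1), ι (coeff d A) * (ι (coeff n (Q ^ d)) * z ^ n)) :=
      hasSum_sum_of_ne_finset_zero fun d hd ↦ by
        rw [Finset.mem_range, not_lt] at hd
        rw [coeff_pow_eq_zero_of_lt hQ0 (by omega), map_zero, zero_mul, mul_zero]
    have hv : ∑ d ∈ Finset.range (n + 1), ι (coeff d A) * (ι (coeff n (Q ^ d)) * z ^ n) =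
        ι (coeff n (A.subst Q)) * z ^ n := by
      rw [coeff_subst_eq_sum_range hQ0 n, map_sum, Finset.sum_mul]
      exact Finset.sum_congr rfl fun d _ ↦ by rw [map_mul]; ring
    rw [← hv]
    exact hfin
  rw [hval, ← (Equiv.prodComm ℕ ℕ).tsum_eq]
  exact h2

end SubstEval

end Summit.BirchSwinnertonDyer.Rank1Residual.Additive

end
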